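import Summits.MatrixMultiplication.MatrixMultiplication.Theses.FarEdgeDescent
import Literature.Computability.AlgebraicComplexity.RectangularExponentInformationBound
import HarnessLib

/-!
# Route `FarEdgeDescent` — the CHORD under the crux `AnchoredLogConvexity` (stmt-MatrixMultiplication-28900),
the exactness of the node, and the halving skeleton the deciding theorem uses — all PROVED

Support module for the rank-2 crux `AnchoredLogConvexity` (`∀ m > 1, e(m)² ≤ e(1)·e(2m−1)`, where
`e(x) := ω(1,x,1) − (x+1)` is the rectangular excess on the real shape axis `⟨n, n^x, n⟩`).  Three groups of
theorems about the TRUE exponents, no hypotheses: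

* §1 THE T3 RUNG `alc_chord`: `e(m) ≤ (e(1) + e(2m−1))/2` for every real `m ≥ 1` — the Lotti–Romani CHORD
  between the square and the shape `2m − 1` (joint convexity of `(x,y,z) ↦ ω(x,y,z)`,
  `LottiRomani1983_convexComb_le` with weights ½, ½).  The crux is WORD FOR WORD the geometric-mean upgrade of
  this arithmetic-mean interpolation (`alc_iff_geomMean`), i.e. it asserts that the chord's slack is at least
  the AM–GM gain `(√e(1) − √e(2m−1))²/2` (`alc_iff_chordGain`) — zero iff `e(2m−1) = e(1)`, maximal (`= e(1)/2`)
  exactly at a far zero, where it is the halving step of §3.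
* §2 THE NODE IS EXACT: `ω = 2 ⟺ FiniteSaturation ∧ AnchoredLogConvexity` (`node_iff`; the `⇐` direction is
  the route's deciding theorem `Theses.FarEdgeDescent.closes`, the `⇒` direction is the Huang–Pan sandwich
  `omegaRect_eq_sub_min_of_omega_eq_two`).  Both leaves are CONSEQUENCES of the summit, so neither can be
  refuted without refuting `ω = 2`.
* §3 THE SKELETON `closes` USES: under the crux a saturated real shape `k > 1` propagates to `(k+1)/2`
  (`halving_step`) and hence along the whole orbit `k_n = 1 + (k₀−1)/2ⁿ → 1⁺` (`orbit_saturated`); the zero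
  propagation alone is exactly the residual `(∃ real k > 1, e(k) = 0) → ω = 2` (`zeroPropagation_iff_residual`)
  — the honest statement of which part of the crux is load-bearing for `closes` and which part (the inequality
  in zero-free worlds) is its surplus.

Written by the decomp-mm lens-2 planner seat (gen 8) from the kernel `HOME/decomp-mm-lens-2/FarEdgeDescent_v7.lean`
(§A, «Necessity», «Honesty certificate»); imports only BUILT modules (the route file + Literature).
[cite: LottiRomani1983, §2 (p. 174)] [cite: HuangPan1998, §8]
-/

set_option linter.dupNamespace false

noncomputable section

namespace Summit.MatrixMultiplication.MatrixMultiplication.Theorems.FarEdgeDescentChord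

open Literature.Computability.AlgebraicComplexity
open Summit.MatrixMultiplication.MatrixMultiplication.Theses.FarEdgeDescent

/-! ## §0 Profile facts (tree theorems, in the excess form the crux uses; the general `e(x) ≥ 0` is the
tree's `add_one_le_omegaRect_one_mid_one`, landed in excess form as `FarEdgeDescentGlue.excess_nonneg`) -/

/-- `e(1) = ω − 2 ≥ 0` in the form the crux uses. -/
theorem excess_one_nonneg : 0 ≤ omegaRect ℂ 1 1 1 - 2 := by
  have h := add_one_le_omegaRect_one_mid_one ℂ (1 : ℝ)
  linarith

/-- `e(2m−1) ≥ 0` in the form the crux uses. -/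
theorem excess_nonneg_two (m : ℝ) : 0 ≤ omegaRect ℂ 1 (2 * m - 1) 1 - 2 * m := by
  have h := add_one_le_omegaRect_one_mid_one ℂ (2 * m - 1)
  linarith

/-- `e` is non-increasing in the shape (tree `omegaRect_one_mid_one_le_add`: `ω(1,·,1)` is 1-Lipschitz). -/
theorem excess_antitone {x y : ℝ} (hyx : y ≤ x) :
    omegaRect ℂ 1 x 1 - (x + 1) ≤ omegaRect ℂ 1 y 1 - (y + 1) := by
  have h := omegaRect_one_mid_one_le_add ℂ (p := x) (q := y) hyx
  linarith

/-! ## §1 The T3 rung: the additive shadow of the crux is a theorem -/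

/-- **T3 RUNG (PROVED, unconditional).** The Lotti–Romani CHORD between the square and the shape `2m − 1`:
`e(m) ≤ (e(1) + e(2m−1))/2` for every real `m ≥ 1` (joint convexity, weights ½,½ at `(1,1,1)` and
`(1,2m−1,1)`). -/
theorem alc_chord {m : ℝ} (hm : 1 ≤ m) :
    omegaRect ℂ 1 m 1 - (m + 1) ≤
      ((omegaRect ℂ 1 1 1 - 2) + (omegaRect ℂ 1 (2 * m - 1) 1 - 2 * m)) / 2 := by
  have hm' : (0 : ℝ) ≤ 2 * m - 1 := by linarith
  have h := LottiRomani1983_convexComb_le ℂ (x := 1) (y := 1) (z := 1) (x' := 1) (y' := 2 * m - 1)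
    (z' := 1) (a := 1 / 2) (b := 1 / 2) zero_le_one zero_le_one zero_le_one zero_le_one hm'
    zero_le_one (by norm_num) (by norm_num)
  have e1 : (1 / 2 : ℝ) * 1 + 1 / 2 * 1 = 1 := by norm_num
  have e2 : (1 / 2 : ℝ) * 1 + 1 / 2 * (2 * m - 1) = m := by ring
  rw [e1, e2] at h
  linarith

/-- `AnchoredLogConvexity` ⟺ the GEOMETRIC-mean chord `e(m) ≤ √(e(1)·e(2m−1))` for `m > 1`. -/
theorem alc_iff_geomMean : AnchoredLogConvexity ↔
    ∀ m : ℝ, 1 < m → omegaRect ℂ 1 m 1 - (m + 1) ≤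
      Real.sqrt ((omegaRect ℂ 1 1 1 - 2) * (omegaRect ℂ 1 (2 * m - 1) 1 - 2 * m)) := by
  refine ⟨fun hA m hm => Real.le_sqrt_of_sq_le (hA m hm), fun h m hm => ?_⟩
  have h0 : 0 ≤ omegaRect ℂ 1 m 1 - (m + 1) := by
    have h' := add_one_le_omegaRect_one_mid_one ℂ m
    linarith
  exact (Real.le_sqrt h0 (mul_nonneg excess_one_nonneg (excess_nonneg_two m))).1 (h m hm)

/-- The AM→GM GAIN form: the crux says the chord's slack is at least `(√e(1) − √e(2m−1))²/2`. -/
theorem alc_iff_chordGain : AnchoredLogConvexity ↔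
    ∀ m : ℝ, 1 < m → omegaRect ℂ 1 m 1 - (m + 1) ≤
      ((omegaRect ℂ 1 1 1 - 2) + (omegaRect ℂ 1 (2 * m - 1) 1 - 2 * m)) / 2 -
        (Real.sqrt (omegaRect ℂ 1 1 1 - 2) - Real.sqrt (omegaRect ℂ 1 (2 * m - 1) 1 - 2 * m)) ^ 2 / 2 := by
  rw [alc_iff_geomMean]
  refine forall_congr' fun m => forall_congr' fun hm => ?_
  have h1 := Real.sq_sqrt excess_one_nonneg
  have h2 := Real.sq_sqrt (excess_nonneg_two m)
  rw [Real.sqrt_mul' _ (excess_nonneg_two m)]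
  constructor <;> intro h <;> nlinarith [h1, h2]

/-- The crux holds trivially at every `m` with `e(2m−1) = e(1)` (then `e(m) = e(1)` too, by monotonicity):
its content is concentrated where the excess has already DROPPED between the square and `2m − 1`. -/
theorem alc_at_of_excess_eq {m : ℝ} (hm : 1 < m)
    (he : omegaRect ℂ 1 (2 * m - 1) 1 - 2 * m = omegaRect ℂ 1 1 1 - 2) :
    (omegaRect ℂ 1 m 1 - (m + 1)) ^ 2 ≤ (omegaRect ℂ 1 1 1 - 2) * (omegaRect ℂ 1 (2 * m - 1) 1 - 2 * m) := by
  have hup : omegaRect ℂ 1 m 1 - (m + 1) ≤ omegaRect ℂ 1 1 1 - 2 := by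
    have h := excess_antitone (x := m) (y := 1) hm.le
    linarith
  have hlo : omegaRect ℂ 1 1 1 - 2 ≤ omegaRect ℂ 1 m 1 - (m + 1) := by
    have h := excess_antitone (x := 2 * m - 1) (y := m) (by linarith)
    linarith
  have heq : omegaRect ℂ 1 m 1 - (m + 1) = omegaRect ℂ 1 1 1 - 2 := le_antisymm hup hlo
  rw [heq, he, sq]

/-! ## §2 The node is exact: `ω = 2 ⟺ FiniteSaturation ∧ AnchoredLogConvexity` -/

/-- Under `ω = 2` every shape `⟨n, n^x, n⟩` with `x ≥ 1` is saturated (Huang–Pan sandwich, tree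
`omegaRect_eq_sub_min_of_omega_eq_two`). -/
theorem saturated_of_omega_eq_two (hω : omega ℂ = 2) {x : ℝ} (hx : 1 ≤ x) :
    omegaRect ℂ 1 x 1 = x + 1 := by
  have h := omegaRect_eq_sub_min_of_omega_eq_two ℂ hω (r := 1) (s := x) (t := 1) zero_le_one
    (by linarith) zero_le_one
  rw [min_eq_right hx, min_self] at h
  linarith

/-- Necessity of the generic leaf: `ω = 2 → AnchoredLogConvexity` (all three excesses vanish). -/
theorem anchoredLogConvexity_of_mm (h : _root_.MatrixMultiplication) : AnchoredLogConvexity := by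
  rw [_root_.MatrixMultiplication_iff] at h
  intro m hm
  rw [saturated_of_omega_eq_two h hm.le, saturated_of_omega_eq_two h (x := 2 * m - 1) (by linarith),
    omegaRect_one_one_one, h]
  nlinarith

/-- Necessity of the special leaf: `ω = 2 → FiniteSaturation` (witness `k = 2`). -/
theorem finiteSaturation_of_mm (h : _root_.MatrixMultiplication) : FiniteSaturation := by
  rw [_root_.MatrixMultiplication_iff] at h
  exact ⟨2, le_rfl, by exact_mod_cast saturated_of_omega_eq_two h (x := 2) (by norm_num)⟩

/-- **The node is exact**: `ω(ℂ) = 2 ⟺ FiniteSaturation ∧ AnchoredLogConvexity`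
(`⇐` = the route's deciding theorem `Theses.FarEdgeDescent.closes`). -/
theorem node_iff : _root_.MatrixMultiplication ↔ FiniteSaturation ∧ AnchoredLogConvexity :=
  ⟨fun h => ⟨finiteSaturation_of_mm h, anchoredLogConvexity_of_mm h⟩, fun h => closes h.1 h.2⟩

/-! ## §3 The skeleton the deciding theorem uses: halving zero-propagation -/

/-- **Halving step.**  Under `AnchoredLogConvexity`, saturation at a real shape `k > 1` forces saturation at
`(k+1)/2`: `e((k+1)/2)² ≤ e(1)·e(k) = 0`. -/
theorem halving_step (hA : AnchoredLogConvexity) {k : ℝ} (hk : 1 < k)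
    (hs : omegaRect ℂ 1 k 1 = k + 1) : omegaRect ℂ 1 ((k + 1) / 2) 1 = (k + 1) / 2 + 1 := by
  have h := hA ((k + 1) / 2) (by linarith)
  have hz : omegaRect ℂ 1 (2 * ((k + 1) / 2) - 1) 1 - 2 * ((k + 1) / 2) = 0 := by
    rw [show 2 * ((k + 1) / 2) - 1 = k by ring, hs]; ring
  rw [hz, mul_zero] at h
  have hsq := le_antisymm h (sq_nonneg _)
  have hlin := (pow_eq_zero_iff two_ne_zero).1 hsq
  linarith

/-- **The halving orbit is saturated**: from a saturated real shape `k₀ > 1`, every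
`k_n = 1 + (k₀−1)/2ⁿ` is saturated. -/
theorem orbit_saturated (hA : AnchoredLogConvexity) {k₀ : ℝ} (hk₀ : 1 < k₀)
    (hs : omegaRect ℂ 1 k₀ 1 = k₀ + 1) (n : ℕ) :
    omegaRect ℂ 1 (1 + (k₀ - 1) / 2 ^ n) 1 = (1 + (k₀ - 1) / 2 ^ n) + 1 := by
  induction n with
  | zero =>
    have e : 1 + (k₀ - 1) / 2 ^ 0 = k₀ := by rw [pow_zero, div_one]; ring
    rw [e]; exact hs
  | succ n ih =>
    have hpos : 0 < (k₀ - 1) / 2 ^ n := div_pos (by linarith) (pow_pos two_pos n)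
    have h := halving_step hA (k := 1 + (k₀ - 1) / 2 ^ n) (by linarith) ih
    have e : (1 + (k₀ - 1) / 2 ^ n + 1) / 2 = 1 + (k₀ - 1) / 2 ^ (n + 1) := by
      rw [pow_succ]; field_simp; ring
    rw [e] at h
    exact h

/-- **Closing at the square by convexity**: saturation at a real shape `k ≥ 1` gives `ω ≤ 3 − 1/k`
(chord from the anchor `ω(1,0,1) = 2` to `(1,k,1)`, read at the square). -/
theorem omega_le_three_sub_inv_of_saturated {k : ℝ} (hk : 1 ≤ k) (hs : omegaRect ℂ 1 k 1 = k + 1) :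
    omega ℂ ≤ 3 - 1 / k := by
  have hk0 : 0 < k := by linarith
  have ha : 0 ≤ 1 - 1 / k := by rw [sub_nonneg, div_le_one hk0]; exact hk
  have hb : (0 : ℝ) ≤ 1 / k := by positivity
  have h := LottiRomani1983_convexComb_le ℂ (x := 1) (y := 0) (z := 1) (x' := 1) (y' := k) (z' := 1)
    (a := 1 - 1 / k) (b := 1 / k) zero_le_one le_rfl zero_le_one zero_le_one hk0.le zero_le_one ha hb
  have e1 : (1 - 1 / k) * 1 + 1 / k * 1 = (1 : ℝ) := by ring
  have e2 : (1 - 1 / k) * 0 + 1 / k * k = (1 : ℝ) := by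
    rw [mul_zero, zero_add, one_div, inv_mul_cancel₀ hk0.ne']
  rw [e1, e2, omegaRect_one_one_one, omegaRect_one_zero_one, hs] at h
  have e3 : (1 - 1 / k) * 2 + 1 / k * (k + 1) = 3 - 1 / k := by
    field_simp; ring
  linarith

/-- Saturation at real shapes ARBITRARILY CLOSE to the square gives `ω = 2`. -/
theorem mm_of_saturation_near_square
    (h : ∀ ε : ℝ, 0 < ε → ∃ k : ℝ, 1 < k ∧ k < 1 + ε ∧ omegaRect ℂ 1 k 1 = k + 1) :
    _root_.MatrixMultiplication := by
  rw [_root_.MatrixMultiplication_iff]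
  have hge : 2 ≤ omega ℂ := by
    have h1 := add_one_le_omegaRect_one_mid_one ℂ (1 : ℝ)
    rw [omegaRect_one_one_one] at h1
    linarith
  refine le_antisymm ?_ hge
  by_contra hlt
  rw [not_le] at hlt
  obtain ⟨k, hk1, hkε, hs⟩ := h ((omega ℂ - 2) / 2) (by linarith)
  have hb := omega_le_three_sub_inv_of_saturated hk1.le hs
  have hk0 : 0 < k := by linarith
  -- 3 − 1/k − 2 = (k−1)/k ≤ k − 1 < (ω−2)/2 < ω − 2: contradiction
  have hkk : 1 - 1 / k ≤ k - 1 := by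
    rw [show 1 - 1 / k = (k - 1) / k by field_simp]
    exact div_le_self (by linarith) hk1.le
  linarith

/-- **The zero-propagation skeleton IS the residual** of the special piece (given the tree's profile
theorems): `(∀ m > 1, e(2m−1) = 0 → e(m) = 0) ⟺ ((∃ real k > 1, e(k) = 0) → ω = 2)`.  The crux
`AnchoredLogConvexity` implies the left side (`halving_step`); its SURPLUS over the residual is the
inequality `e(m)² ≤ e(1)e(2m−1)` in zero-free worlds. -/
theorem zeroPropagation_iff_residual :
    (∀ m : ℝ, 1 < m → omegaRect ℂ 1 (2 * m - 1) 1 = 2 * m → omegaRect ℂ 1 m 1 = m + 1) ↔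
      ((∃ k : ℝ, 1 < k ∧ omegaRect ℂ 1 k 1 = k + 1) → _root_.MatrixMultiplication) := by
  constructor
  · rintro hH ⟨k₀, hk₀, hs₀⟩
    -- run the orbit with the skeleton alone
    have orbit : ∀ n : ℕ, omegaRect ℂ 1 (1 + (k₀ - 1) / 2 ^ n) 1 = (1 + (k₀ - 1) / 2 ^ n) + 1 := by
      intro n
      induction n with
      | zero =>
        have e : 1 + (k₀ - 1) / 2 ^ 0 = k₀ := by rw [pow_zero, div_one]; ring
        rw [e]; exact hs₀
      | succ n ih =>
        have hpos : 0 < (k₀ - 1) / 2 ^ (n + 1) := div_pos (by linarith) (pow_pos two_pos _)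
        have e1 : 2 * (1 + (k₀ - 1) / 2 ^ (n + 1)) - 1 = 1 + (k₀ - 1) / 2 ^ n := by
          rw [pow_succ]; field_simp; ring
        have h := hH (1 + (k₀ - 1) / 2 ^ (n + 1)) (by linarith)
        rw [e1] at h
        have e2 : (2 : ℝ) * (1 + (k₀ - 1) / 2 ^ (n + 1)) = 1 + (k₀ - 1) / 2 ^ n + 1 := by linarith [e1]
        rw [e2] at h
        exact h ih
    refine mm_of_saturation_near_square fun ε hε => ?_
    have hk1 : 0 < k₀ - 1 := by linarith
    obtain ⟨n, hn⟩ := exists_pow_lt_of_lt_one (div_pos hε hk1) (by norm_num : (1 / 2 : ℝ) < 1)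
    refine ⟨1 + (k₀ - 1) / 2 ^ n, ?_, ?_, orbit n⟩
    · have : 0 < (k₀ - 1) / 2 ^ n := div_pos hk1 (pow_pos two_pos n)
      linarith
    · have e : (k₀ - 1) / 2 ^ n = (1 / 2) ^ n * (k₀ - 1) := by
        rw [one_div_pow, mul_comm, ← div_eq_mul_one_div]
      rw [lt_div_iff₀ hk1] at hn
      rw [e]; linarith
  · intro hres m hm hz
    have hS : _root_.MatrixMultiplication := hres ⟨2 * m - 1, by linarith, by rw [hz]; ring⟩
    rw [_root_.MatrixMultiplication_iff] at hS
    exact saturated_of_omega_eq_two hS hm.le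

/-- The integer special leaf is as good as a real one: `FiniteSaturation ⟺ ∃ real k > 1, e(k) = 0`
(`⇐`: `e` is non-increasing and nonnegative, so a real zero at `k` gives an integer zero at `⌈k⌉ ≥ 2`). -/
theorem finiteSaturation_iff_realSaturation :
    FiniteSaturation ↔ ∃ k : ℝ, 1 < k ∧ omegaRect ℂ 1 k 1 = k + 1 := by
  constructor
  · rintro ⟨k, hk, hs⟩
    exact ⟨k, by exact_mod_cast (by omega : 1 < k), hs⟩
  · rintro ⟨k, hk, hs⟩
    refine ⟨⌈k⌉₊, ?_, ?_⟩
    · have h2 : (1 : ℝ) < ⌈k⌉₊ := lt_of_lt_of_le hk (Nat.le_ceil k)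
      exact_mod_cast h2
    · have hle : k ≤ (⌈k⌉₊ : ℝ) := Nat.le_ceil k
      have h1 := excess_antitone (x := (⌈k⌉₊ : ℝ)) (y := k) hle
      have h0 := add_one_le_omegaRect_one_mid_one ℂ ((⌈k⌉₊ : ℝ))
      rw [hs] at h1
      linarith

end Summit.MatrixMultiplication.MatrixMultiplication.Theorems.FarEdgeDescentChord

end
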